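import Mathlib.LinearAlgebra.Matrix.Determinant.Basic
import Mathlib.Data.Matrix.Basic
import Mathlib.Algebra.BigOperators.Fin
import Mathlib.Tactic.Ring
import Mathlib.Tactic.FinCases

/-!
# `(3,4)` symmetric pencils — the NODE-FRAME (Cauchy–Binet) normal form of the determinant (engine-5 g12, E5G12-SYMNODE §2)

HONEST FRAMING.  Object-search cell `pub-symmetroid`, crux `Theses.LacunarySymmetroid.MatrixDescartes`
(stmt-ValiantsHypothesis-18050); this file sits beside ONE typed statement `DoorA34 = PosRootLawAt 3 4 18`
(OPEN, never asserted here).  It is elementary exact algebra: the kernel form of the identity the cell's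
(3,4) node-frame instruments use (engine-2 CUBIC-REREP §7, engine-6 «REMARK E», engine-5 E5G12-SYMNODE):
if the letters of a real symmetric `3 × 3` pencil lie in the span of four rank-one matrices `v_i v_iᵀ`
(the nodes of the cubic symmetroid; `V` = the `3 × 4` matrix with columns `v_i`), i.e.
`S l = V * diagonal (c l) * Vᵀ`, then for all weights `w`
`det (∑ l, w l • S l) = ∑ i, det(V without column i)² · ∏_{j ≠ i} ℓ_j`,  `ℓ_j = ∑ l, w l * c l j`
(Cauchy–Binet for `3 × 4`): the determinant is the squared-minor-weighted third elementary symmetric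
function of the four «node fewnomials».  It proves NO bound on any root count and says nothing about
`MatrixDescartes` or `VP ≠ VNP`.

[folklore] Cauchy–Binet, written out for a `3 × 4` frame.
-/

-- `Summit.ValiantsHypothesis.ValiantsHypothesis.…` repeats a component by the D-0017 layout
-- (single-conjunct summit), which the `dupNamespace` linter flags; the name is mandated.
set_option linter.dupNamespace false

namespace Summit.ValiantsHypothesis.ValiantsHypothesis.Theorems.LacunarySymmetroidMatrixDescartes.Census

open Matrix

/-- Entries of the frame form: `(V * diagonal ℓ * Vᵀ) i j = ∑ k, V i k * ℓ k * V j k`. -/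
theorem frame_diagonal_apply {R : Type*} [CommRing R] {n : ℕ} (V : Matrix (Fin 3) (Fin n) R)
    (ℓ : Fin n → R) (i j : Fin 3) :
    (V * Matrix.diagonal ℓ * Vᵀ) i j = ∑ k, V i k * ℓ k * V j k := by
  rw [Matrix.mul_apply]
  refine Finset.sum_congr rfl (fun k _ => ?_)
  rw [Matrix.mul_diagonal, Matrix.transpose_apply]

/-- **Cauchy–Binet for a `3 × 4` frame.**  For a `3 × 4` matrix `V` over a commutative ring and weights `ℓ`,
`det (V * diagonal ℓ * Vᵀ)` is the sum over the four columns `i` of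
`det(V without column i)² · ∏_{j ≠ i} ℓ j`. -/
theorem det_frame_diagonal {R : Type*} [CommRing R] (V : Matrix (Fin 3) (Fin 4) R) (ℓ : Fin 4 → R) :
    (V * Matrix.diagonal ℓ * Vᵀ).det =
      (V.submatrix id ![(1 : Fin 4), 2, 3]).det ^ 2 * (ℓ 1 * ℓ 2 * ℓ 3)
      + (V.submatrix id ![(0 : Fin 4), 2, 3]).det ^ 2 * (ℓ 0 * ℓ 2 * ℓ 3)
      + (V.submatrix id ![(0 : Fin 4), 1, 3]).det ^ 2 * (ℓ 0 * ℓ 1 * ℓ 3)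
      + (V.submatrix id ![(0 : Fin 4), 1, 2]).det ^ 2 * (ℓ 0 * ℓ 1 * ℓ 2) := by
  simp only [Matrix.det_fin_three, frame_diagonal_apply, Fin.sum_univ_four, Matrix.submatrix_apply,
    id, Matrix.cons_val_zero, Matrix.cons_val_one, Matrix.head_cons, Matrix.cons_val_two,
    Matrix.tail_cons]
  ring

/-- Standard real node frame `e₁, e₂, e₃, e₁+e₂+e₃`: `det (diagonal (a,b,c) + d·𝟙𝟙ᵀ)` is the third elementary
symmetric function `e₃(a,b,c,d) = abc + d(ab + ac + bc)` — Cayley's four-nodal cubic in node coordinates. -/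
theorem det_diagonal_add_const {R : Type*} [CommRing R] (a b c d : R) :
    (Matrix.diagonal ![a, b, c] + Matrix.of (fun (_ : Fin 3) (_ : Fin 3) => d)).det
      = a * b * c + d * (a * b + a * c + b * c) := by
  simp [Matrix.det_fin_three]
  ring

/-- **Node-frame normal form of a pencil (the cell's REMARK E, kernel form).**  If every letter of a `K`-term
pencil is `V * diagonal (c l) * Vᵀ` for one `3 × 4` frame `V`, then for arbitrary weights `w` (for a lacunary
pencil `w l = x ^ d l`) the determinant of `∑ l, w l • (V * diagonal (c l) * Vᵀ)` is the squared-minor-weighted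
`e₃` of the four node fewnomials `ℓ j = ∑ l, w l * c l j`. -/
theorem det_sum_smul_frame {R : Type*} [CommRing R] {K : ℕ} (V : Matrix (Fin 3) (Fin 4) R)
    (c : Fin K → Fin 4 → R) (w : Fin K → R) :
    (∑ l, w l • (V * Matrix.diagonal (c l) * Vᵀ)).det =
      (V.submatrix id ![(1 : Fin 4), 2, 3]).det ^ 2 *
          ((∑ l, w l * c l 1) * (∑ l, w l * c l 2) * (∑ l, w l * c l 3))
      + (V.submatrix id ![(0 : Fin 4), 2, 3]).det ^ 2 *
          ((∑ l, w l * c l 0) * (∑ l, w l * c l 2) * (∑ l, w l * c l 3))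
      + (V.submatrix id ![(0 : Fin 4), 1, 3]).det ^ 2 *
          ((∑ l, w l * c l 0) * (∑ l, w l * c l 1) * (∑ l, w l * c l 3))
      + (V.submatrix id ![(0 : Fin 4), 1, 2]).det ^ 2 *
          ((∑ l, w l * c l 0) * (∑ l, w l * c l 1) * (∑ l, w l * c l 2)) := by
  have h : (∑ l, w l • (V * Matrix.diagonal (c l) * Vᵀ)) =
      V * Matrix.diagonal (fun j => ∑ l, w l * c l j) * Vᵀ := by
    ext i j
    rw [Matrix.sum_apply, frame_diagonal_apply]
    simp only [Matrix.smul_apply, frame_diagonal_apply, smul_eq_mul, Finset.mul_sum]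
    rw [Finset.sum_comm]
    refine Finset.sum_congr rfl (fun k _ => ?_)
    rw [Finset.sum_mul]
    refine Finset.sum_congr rfl (fun l _ => ?_)
    ring
  rw [h, det_frame_diagonal]

end Summit.ValiantsHypothesis.ValiantsHypothesis.Theorems.LacunarySymmetroidMatrixDescartes.Census
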